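import Summits.CriticalPhenomena.PercolationContinuityZ3.Theorems.PercNearOneGluingNoHeavyLowerTailQ7PsiZFree
import HarnessLib

/-!
# `NoHeavyLowerTail` (stmt-CriticalPhenomena-4575) — (GΨ₃) from the two halves of the dual certificate
# (bookkeeping of the census certificate `t* = φE1/(φE1+φE2)`)

Support file (`--supports stmt-CriticalPhenomena-4575`), coupling seat `prim-cplus-coupling` (gen 7).  No
definitions, no named facts, no sorries.

Context (seat memos A5-COUPLING-gen5.md §4, A5-COUPLING-gen7.md §0–§2; ttrl q7psi RESULT 3).  For a finite
weighted graph, a monotone real cluster property `F`, an observer `o`, strong relays `x, y` and a weak relay `z`,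
the conjecture (GΨ₃) — `E F(C(z)) ≤ E F(C(x)), E F(C(y))` imply `∫_{o↔x ∪ o↔y} F(C(z)) ≤ ∫_{o↔x ∪ o↔y} F(C(o))` —
is certified (exactly, on every instance of the census) by one point `(λ*, μ*)` of the dual mass-balance line.
The certificate `Λ = Ψ − λ Dx − μ Dy ≥ 0` is the difference of an "observer part" (O*) and a "weak-relay part"
(Z*), and (O*) is the sum of an `x`-half (P1*) and a `y`-half (P2*) (memo gen7 §0.1–0.2).  This file does the
bookkeeping once and for all, for ARBITRARY multipliers `λ, μ` and split `t` (so that a future proof of the two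
halves and of the weak-relay part closes (GΨ₃) by `gpsi_three_of_dom ∘ opart_of_halves`):

* `Q7Psi.opart_of_halves` — with `D_xz = {x ↮ z}`, `D_yz = {y ↮ z}`, `J' = (o↔x ∪ o↔y) ∩ {o ↮ z}`:
  if `λ ∫_{D_xz} F(C x) ≤ ∫_{x↔o, x↮y, x↮z} F(C x) + t ∫_{x↔o, x↔y, x↮z} F(C x)` (P1*) and
  `μ ∫_{D_yz} F(C y) ≤ ∫_{y↔o, y↮x, y↮z} F(C y) + (1−t) ∫_{y↔o, y↔x, y↮z} F(C y)` (P2*), then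
  `λ ∫_{D_xz} F(C x) + μ ∫_{D_yz} F(C y) ≤ ∫_{J'} F(C o)` (O*) — because `J'` is the disjoint union of the three
  observer worlds `{x↔o}∩E1`, `{y↔o}∩E2`, `{x↔o}∩F`, on which `C(o)` is `C(x)`, `C(y)`, `C(x) = C(y)`;
* `Q7Psi.gpsi_three_of_dom` — if (O*) holds, the weak-relay part satisfies
  `∫_{J'} F(C z) ≤ λ ∫_{D_xz} F(C z) + μ ∫_{D_yz} F(C z)` (Z*), `λ, μ ≥ 0`, and the (GΨ₃) hypotheses hold, then
  the (GΨ₃) conclusion holds (on `{o ↔ z}` the two clusters coincide; on `{x ↔ z}` resp. `{y ↔ z}` likewise).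
No monotonicity of `F` is needed in this file (pure event bookkeeping and real arithmetic).
[cite: KozmaNitzan2024, §5.1 (pp. 31–32), Question 7 (p. 36)]
-/

namespace Summit.CriticalPhenomena.PercolationContinuityZ3.Theorems

open MeasureTheory Set Literature.Probability.LatticeModels Literature.Probability.Percolation
open scoped Classical
open KNPreFKG

noncomputable section

namespace Q7Psi

variable {V : Type*} [Fintype V]

/-- **(O*) from its two halves.**  With `D_xz = {x ↮ z}`, `D_yz = {y ↮ z}` and
`J' = (o↔x ∪ o↔y) ∩ {o ↮ z}`: the `x`-half (P1*) and the `y`-half (P2*) of the dual certificate (any split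
`t`, any multipliers `λ, μ`) add up to the observer part
`λ ∫_{D_xz} F(C x) + μ ∫_{D_yz} F(C y) ≤ ∫_{J'} F(C o)`.  Pure bookkeeping: `J'` is the disjoint union of
`{x↔o, x↮y, x↮z}` (where `C o = C x`), `{y↔o, y↮x, y↮z}` (where `C o = C y`) and `{x↔o, x↔y, x↮z}`
(`= {y↔o, y↔x, y↮z}`, where `C o = C x = C y`). [cite: KozmaNitzan2024, §5.1 (pp. 31–32)] -/
theorem opart_of_halves (w : Sym2 V → unitInterval) (o x y z : V) (F : Set V → ℝ) (t lam mu : ℝ)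
    (hP1 : lam * ∫ ω in {ω : BondConfig V | ¬ (openGraph ω).Reachable x z}, F (openCluster ω x) ∂(prodBernoulli w) ≤
      (∫ ω in openConn x o ∩ {ω | ¬ (openGraph ω).Reachable x y} ∩ {ω | ¬ (openGraph ω).Reachable x z},
          F (openCluster ω x) ∂(prodBernoulli w)) +
        t * ∫ ω in openConn x o ∩ openConn x y ∩ {ω | ¬ (openGraph ω).Reachable x z},
          F (openCluster ω x) ∂(prodBernoulli w))
    (hP2 : mu * ∫ ω in {ω : BondConfig V | ¬ (openGraph ω).Reachable y z}, F (openCluster ω y) ∂(prodBernoulli w) ≤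
      (∫ ω in openConn y o ∩ {ω | ¬ (openGraph ω).Reachable y x} ∩ {ω | ¬ (openGraph ω).Reachable y z},
          F (openCluster ω y) ∂(prodBernoulli w)) +
        (1 - t) * ∫ ω in openConn y o ∩ openConn y x ∩ {ω | ¬ (openGraph ω).Reachable y z},
          F (openCluster ω y) ∂(prodBernoulli w)) :
    lam * (∫ ω in {ω : BondConfig V | ¬ (openGraph ω).Reachable x z}, F (openCluster ω x) ∂(prodBernoulli w)) +
        mu * (∫ ω in {ω : BondConfig V | ¬ (openGraph ω).Reachable y z}, F (openCluster ω y) ∂(prodBernoulli w)) ≤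
      ∫ ω in (openConn o x ∪ openConn o y) ∩ {ω | ¬ (openGraph ω).Reachable o z},
        F (openCluster ω o) ∂(prodBernoulli w) := by
  classical
  set μ := prodBernoulli w with hμ
  set S1 : Set (BondConfig V) :=
    openConn x o ∩ {ω | ¬ (openGraph ω).Reachable x y} ∩ {ω | ¬ (openGraph ω).Reachable x z} with hS1
  set S2 : Set (BondConfig V) :=
    openConn y o ∩ {ω | ¬ (openGraph ω).Reachable y x} ∩ {ω | ¬ (openGraph ω).Reachable y z} with hS2
  set S3 : Set (BondConfig V) := openConn x o ∩ openConn x y ∩ {ω | ¬ (openGraph ω).Reachable x z} with hS3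
  set S3' : Set (BondConfig V) := openConn y o ∩ openConn y x ∩ {ω | ¬ (openGraph ω).Reachable y z} with hS3'
  set J' : Set (BondConfig V) := (openConn o x ∪ openConn o y) ∩ {ω | ¬ (openGraph ω).Reachable o z} with hJ'
  have hmeas : ∀ S : Set (BondConfig V), MeasurableSet S := fun _ => MeasurableSet.of_discrete
  have hint : ∀ (g : BondConfig V → ℝ) (S : Set (BondConfig V)), IntegrableOn g S μ :=
    fun g S => (Integrable.of_finite).integrableOn
  -- `S3 = S3'`
  have h33 : S3 = S3' := by
    ext ω
    simp only [hS3, hS3', mem_inter_iff, mem_setOf_eq, openConn]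
    constructor
    · rintro ⟨⟨hxo, hxy⟩, hxz⟩
      exact ⟨⟨hxy.symm.trans hxo, hxy.symm⟩, fun hyz => hxz (hxy.trans hyz)⟩
    · rintro ⟨⟨hyo, hyx⟩, hyz⟩
      exact ⟨⟨hyx.symm.trans hyo, hyx.symm⟩, fun hxz => hyz (hyx.trans hxz)⟩
  -- `J' = S1 ∪ S2 ∪ S3`, pairwise disjoint
  have hJeq : J' = (S1 ∪ S2) ∪ S3 := by
    ext ω
    simp only [hJ', hS1, hS2, hS3, mem_inter_iff, mem_union, mem_setOf_eq, openConn]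
    constructor
    · rintro ⟨hJ, hoz⟩
      by_cases hox : (openGraph ω).Reachable o x
      · by_cases hxy : (openGraph ω).Reachable x y
        · exact Or.inr ⟨⟨hox.symm, hxy⟩, fun hxz => hoz (hox.trans hxz)⟩
        · exact Or.inl (Or.inl ⟨⟨hox.symm, hxy⟩, fun hxz => hoz (hox.trans hxz)⟩)
      · have hoy : (openGraph ω).Reachable o y := by
          rcases hJ with h | h
          · exact absurd h hox
          · exact h
        refine Or.inl (Or.inr ⟨⟨hoy.symm, fun hyx => hox (hoy.trans hyx)⟩, fun hyz => hoz (hoy.trans hyz)⟩)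
    · rintro ((⟨⟨hxo, _⟩, hxz⟩ | ⟨⟨hyo, _⟩, hyz⟩) | ⟨⟨hxo, _⟩, hxz⟩)
      · exact ⟨Or.inl hxo.symm, fun hoz => hxz (hxo.trans hoz)⟩
      · exact ⟨Or.inr hyo.symm, fun hoz => hyz (hyo.trans hoz)⟩
      · exact ⟨Or.inl hxo.symm, fun hoz => hxz (hxo.trans hoz)⟩
  have hd12 : Disjoint S1 S2 := by
    rw [Set.disjoint_left]
    rintro ω ⟨⟨hxo, hxy⟩, _⟩ ⟨⟨hyo, _⟩, _⟩
    exact hxy (SimpleGraph.Reachable.trans hxo (SimpleGraph.Reachable.symm hyo))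
  have hd123 : Disjoint (S1 ∪ S2) S3 := by
    rw [Set.disjoint_left]
    rintro ω (⟨⟨_, hxy⟩, _⟩ | ⟨⟨_, hyx⟩, _⟩) ⟨⟨_, hxy'⟩, _⟩
    · exact hxy hxy'
    · exact hyx (SimpleGraph.Reachable.symm hxy')
  -- split the integral over `J'`
  have hsplit : ∫ ω in J', F (openCluster ω o) ∂μ =
      ∫ ω in S1, F (openCluster ω o) ∂μ + ∫ ω in S2, F (openCluster ω o) ∂μ +
        ∫ ω in S3, F (openCluster ω o) ∂μ := by
    rw [hJeq, setIntegral_union hd123 (hmeas _) (hint _ _) (hint _ _),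
      setIntegral_union hd12 (hmeas _) (hint _ _) (hint _ _)]
  -- cluster identifications
  have e1 : ∫ ω in S1, F (openCluster ω o) ∂μ = ∫ ω in S1, F (openCluster ω x) ∂μ := by
    refine setIntegral_congr_fun (hmeas _) fun ω hω => ?_
    rw [openCluster_eq_of_reachable (show (openGraph ω).Reachable x o from hω.1.1)]
  have e2 : ∫ ω in S2, F (openCluster ω o) ∂μ = ∫ ω in S2, F (openCluster ω y) ∂μ := by
    refine setIntegral_congr_fun (hmeas _) fun ω hω => ?_
    rw [openCluster_eq_of_reachable (show (openGraph ω).Reachable y o from hω.1.1)]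
  have e3x : ∫ ω in S3, F (openCluster ω o) ∂μ = ∫ ω in S3, F (openCluster ω x) ∂μ := by
    refine setIntegral_congr_fun (hmeas _) fun ω hω => ?_
    rw [openCluster_eq_of_reachable (show (openGraph ω).Reachable x o from hω.1.1)]
  have e3y : ∫ ω in S3', F (openCluster ω o) ∂μ = ∫ ω in S3', F (openCluster ω y) ∂μ := by
    refine setIntegral_congr_fun (hmeas _) fun ω hω => ?_
    rw [openCluster_eq_of_reachable (show (openGraph ω).Reachable y o from hω.1.1)]
  have e3 : ∫ ω in S3, F (openCluster ω o) ∂μ =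
      t * ∫ ω in S3, F (openCluster ω x) ∂μ + (1 - t) * ∫ ω in S3', F (openCluster ω y) ∂μ := by
    rw [← e3y, ← h33, ← e3x]
    ring
  rw [hsplit, e1, e2, e3]
  linarith

/-- **(GΨ₃) from the dual certificate.**  With `J = o↔x ∪ o↔y`, `J' = J ∩ {o ↮ z}`, `D_xz = {x ↮ z}`,
`D_yz = {y ↮ z}`: if the observer part (O*) `λ ∫_{D_xz} F(C x) + μ ∫_{D_yz} F(C y) ≤ ∫_{J'} F(C o)` and the
weak-relay part (Z*) `∫_{J'} F(C z) ≤ λ ∫_{D_xz} F(C z) + μ ∫_{D_yz} F(C z)` hold with `λ, μ ≥ 0`, then the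
(GΨ₃) hypotheses `∫ F(C z) ≤ ∫ F(C x)`, `∫ F(C z) ≤ ∫ F(C y)` give `∫_J F(C z) ≤ ∫_J F(C o)`.
(On `{x ↔ z}`, `{y ↔ z}`, `{o ↔ z}` the respective clusters coincide, so the hypotheses transfer to `D_xz`, `D_yz`
and the conclusion from `J'` to `J`.)  With the census point `λ* = (a + t*d)/P(x↮z)`, `μ* = (b + (1−t*)d)/P(y↮z)`,
`t* = φE1/(φE1+φE2)` this is the certificate of ttrl q7psi RESULT 3.
[cite: KozmaNitzan2024, §5.1 (pp. 31–32), Question 7 (p. 36)] -/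
theorem gpsi_three_of_dom (w : Sym2 V → unitInterval) (o x y z : V) (F : Set V → ℝ) (lam mu : ℝ)
    (hlam : 0 ≤ lam) (hmu : 0 ≤ mu)
    (hO : lam * (∫ ω in {ω : BondConfig V | ¬ (openGraph ω).Reachable x z}, F (openCluster ω x) ∂(prodBernoulli w)) +
        mu * (∫ ω in {ω : BondConfig V | ¬ (openGraph ω).Reachable y z}, F (openCluster ω y) ∂(prodBernoulli w)) ≤
      ∫ ω in (openConn o x ∪ openConn o y) ∩ {ω | ¬ (openGraph ω).Reachable o z},
        F (openCluster ω o) ∂(prodBernoulli w))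
    (hZ : ∫ ω in (openConn o x ∪ openConn o y) ∩ {ω | ¬ (openGraph ω).Reachable o z},
        F (openCluster ω z) ∂(prodBernoulli w) ≤
      lam * (∫ ω in {ω : BondConfig V | ¬ (openGraph ω).Reachable x z}, F (openCluster ω z) ∂(prodBernoulli w)) +
        mu * (∫ ω in {ω : BondConfig V | ¬ (openGraph ω).Reachable y z}, F (openCluster ω z) ∂(prodBernoulli w)))
    (hx : ∫ ω, F (openCluster ω z) ∂(prodBernoulli w) ≤ ∫ ω, F (openCluster ω x) ∂(prodBernoulli w))
    (hy : ∫ ω, F (openCluster ω z) ∂(prodBernoulli w) ≤ ∫ ω, F (openCluster ω y) ∂(prodBernoulli w)) :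
    ∫ ω in (openConn o x ∪ openConn o y), F (openCluster ω z) ∂(prodBernoulli w) ≤
      ∫ ω in (openConn o x ∪ openConn o y), F (openCluster ω o) ∂(prodBernoulli w) := by
  classical
  set μ := prodBernoulli w with hμ
  set J : Set (BondConfig V) := openConn o x ∪ openConn o y with hJ
  set Doz : Set (BondConfig V) := {ω | ¬ (openGraph ω).Reachable o z} with hDoz
  set Dxz : Set (BondConfig V) := {ω | ¬ (openGraph ω).Reachable x z} with hDxz
  set Dyz : Set (BondConfig V) := {ω | ¬ (openGraph ω).Reachable y z} with hDyz
  have hmeas : ∀ S : Set (BondConfig V), MeasurableSet S := fun _ => MeasurableSet.of_discrete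
  have hint : ∀ (g : BondConfig V → ℝ) (S : Set (BondConfig V)), IntegrableOn g S μ :=
    fun g S => (Integrable.of_finite).integrableOn
  -- the hypotheses restricted to `D_xz`, `D_yz`
  have hx' : ∫ ω in Dxz, F (openCluster ω z) ∂μ ≤ ∫ ω in Dxz, F (openCluster ω x) ∂μ := by
    have ex := integral_add_compl (hmeas Dxz) (Integrable.of_finite : Integrable (fun ω => F (openCluster ω x)) μ)
    have ez := integral_add_compl (hmeas Dxz) (Integrable.of_finite : Integrable (fun ω => F (openCluster ω z)) μ)
    have ec : ∫ ω in Dxzᶜ, F (openCluster ω z) ∂μ = ∫ ω in Dxzᶜ, F (openCluster ω x) ∂μ := by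
      refine setIntegral_congr_fun (hmeas Dxz).compl fun ω hω => ?_
      have hr : (openGraph ω).Reachable x z := by
        by_contra hc
        exact hω hc
      rw [openCluster_eq_of_reachable hr]
    have h' : ∫ ω, F (openCluster ω z) ∂μ ≤ ∫ ω, F (openCluster ω x) ∂μ := hx
    linarith
  have hy' : ∫ ω in Dyz, F (openCluster ω z) ∂μ ≤ ∫ ω in Dyz, F (openCluster ω y) ∂μ := by
    have ey := integral_add_compl (hmeas Dyz) (Integrable.of_finite : Integrable (fun ω => F (openCluster ω y)) μ)
    have ez := integral_add_compl (hmeas Dyz) (Integrable.of_finite : Integrable (fun ω => F (openCluster ω z)) μ)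
    have ec : ∫ ω in Dyzᶜ, F (openCluster ω z) ∂μ = ∫ ω in Dyzᶜ, F (openCluster ω y) ∂μ := by
      refine setIntegral_congr_fun (hmeas Dyz).compl fun ω hω => ?_
      have hr : (openGraph ω).Reachable y z := by
        by_contra hc
        exact hω hc
      rw [openCluster_eq_of_reachable hr]
    have h' : ∫ ω, F (openCluster ω z) ∂μ ≤ ∫ ω, F (openCluster ω y) ∂μ := hy
    linarith
  -- certificate on `J'`
  have hJ' : ∫ ω in J ∩ Doz, F (openCluster ω z) ∂μ ≤ ∫ ω in J ∩ Doz, F (openCluster ω o) ∂μ := by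
    have h1 := mul_le_mul_of_nonneg_left (sub_nonneg.2 hx') hlam
    have h2 := mul_le_mul_of_nonneg_left (sub_nonneg.2 hy') hmu
    have hO' : lam * (∫ ω in Dxz, F (openCluster ω x) ∂μ) + mu * (∫ ω in Dyz, F (openCluster ω y) ∂μ) ≤
        ∫ ω in J ∩ Doz, F (openCluster ω o) ∂μ := hO
    have hZ' : ∫ ω in J ∩ Doz, F (openCluster ω z) ∂μ ≤
        lam * (∫ ω in Dxz, F (openCluster ω z) ∂μ) + mu * (∫ ω in Dyz, F (openCluster ω z) ∂μ) := hZ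
    nlinarith
  -- from `J'` to `J`: on `J \ Doz` the clusters of `o` and `z` coincide
  have hc : ∫ ω in J \ Doz, F (openCluster ω z) ∂μ = ∫ ω in J \ Doz, F (openCluster ω o) ∂μ := by
    refine setIntegral_congr_fun ((hmeas J).diff (hmeas Doz)) fun ω hω => ?_
    have hr : (openGraph ω).Reachable o z := by
      by_contra hc
      exact hω.2 hc
    rw [openCluster_eq_of_reachable hr]
  rw [← integral_inter_add_sdiff (hmeas Doz) (hint _ J), ← integral_inter_add_sdiff (hmeas Doz) (hint _ J), hc]
  linarith

end Q7Psi

end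

end Summit.CriticalPhenomena.PercolationContinuityZ3.Theorems
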